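import Summits.BirchSwinnertonDyer.BirchSwinnertonDyer.Theorems.PrintX11aMultThreeOrbitDefs
import Literature.NumberTheory.EllipticCurves.BSDHeegnerPointsTorsionProofs
import Literature.NumberTheory.EllipticCurves.ModularSymbolsProofs
import HarnessLib

/-!
# Route `PrintX11a`, crux U3 `UpperNonSurjThree` (item stmt-BirchSwinnertonDyer-20613), line finemu3 — μ-road stub
# `stub_muAnHardThree`: the ATKIN–LEHNER PERIOD RELATIONS at `3 ∥ N` (analytic input of the orbit trick)

Cell `bsd-print-x11a`, width seat bsd-line-x11a-p2 g2 (`--supports stmt-BirchSwinnertonDyer-20613 --as helper`). Theorems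
only (no definition, no named fact, no `sorry`); BSD is not proved by any of this; nothing is asserted about any curve.

For `f ∈ S₂(Γ₀(N))` with `3 ∥ N` and `w₃ f = ε f` (`atkinLehnerInvolution N 2 3 f = ε • f`, `ε² = 1`; for a newform
`ε = −a₃(f)`, tree theorem `IsNewform0.atkinLehnerInvolution_eq_smul_of_not_dvd`), writing
`W = w(3) = β(3)·diag(3,1) = (3x, y; N, 3)` (`atkinLehnerW N 3`; integer matrix `MultThreeOrbit.Wint (N/3) x y`):

* `verticalIntegral_slash_tpD` — the ONE new analytic lemma: `V_{φ ∣ diag(p,1)}(τ) = V_φ(p τ)` for ANY `φ : ℍ → ℂ`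
  (affine substitution `s = p t` along the vertical ray; `V = verticalIntegral` of `ModularSymbolsProofs`);
* `exists_eichlerIntegral_alW_smul` — `K`-CONSTANCY: `V_f(W z) = ε V_f(z) + K` for all `z ∈ ℍ` (Manin's
  `V_f(βz) − V_{f∣β}(z) = const` for `β = β(3) ∈ SL₂(ℤ)`, the affine lemma, `f ∣ W = ε f`);
* (i) `cuspSymbol_eq_mul_of_conj_alWInt` — `W`-EQUIVARIANCE OF MANIN'S PERIOD HOMOMORPHISM: `γ' W = W γ` (integer matrices,
  `γ, γ' ∈ Γ₀(N)`) ⟹ `{∞, γ'∞}_f = ε {∞, γ∞}_f`; with `exists_conj_alWInt` (`W` normalises `Γ₀(N)`, Knapp Lemma 9.24);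
* (ii) `cuspSymbol_eq_of_sq_alWInt` — THE PERIOD OF `W²/3`: `W W = 3 γ₀` ⟹
  `{∞, γ₀∞}_f = (1 + ε)({∞, y/3}_f − {∞, 0}_f)` (`y/3 = W·0`); with `exists_sq_alWInt` (Knapp Lemma 9.24),
  via `{∞, g∞}_f = V_f(gτ) − V_{f∣g}(τ)` (`modularSymbol_smul_infty`) at `g = S`, `g = β(3)S` and `diag(3,1) S diag(3,1) = 3S`.
(i) and (ii) are exactly the two `W`-inputs of the kernel theorem `MultThreeOrbit.mem_of_orbitTrick` (σ := ε,
`m γ := [γ0]⁺_f − [0]⁺_f`).  beyond-print: no (standard Atkin–Lehner calculus of modular symbols, MTT §I.17 / Cremona §2.10).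
References: [Manin1972] Prop. 1.4, Thm. 1.6; [Knapp1993] Lemma 9.24, Thm. 9.27; [MazurTateTeitelbaum1986Invent] §I.10, §I.17;
[AtkinLehner1970] Thm. 3; [CremonaAlgorithms1997] §2.10.
-/

set_option linter.dupNamespace false
set_option autoImplicit false

noncomputable section

open scoped MatrixGroups ModularForm

open CongruenceSubgroup Matrix.SpecialLinearGroup Complex MeasureTheory Set
  Literature.NumberTheory.EllipticCurves Literature.NumberTheory.EllipticCurves.ModularForms

namespace Summit.BirchSwinnertonDyer.BirchSwinnertonDyer.Theorems.MultThreeAL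

open UpperHalfPlane hiding I

/-- `diag(p, 1)` maps the vertical ray above `τ` onto the vertical ray above `p τ`:
`diag(p,1) · (τ + it) = pτ + i p t`. [folklore] -/
theorem tpD_smul_ofComplex_coe (p : ℕ) [NeZero p] (τ : ℍ) {t : ℝ} (ht : 0 < t) :
    tpD p • ofComplex ((τ : ℂ) + t * Complex.I) =
      ofComplex (((tpD p • τ : ℍ) : ℂ) + ((p * t : ℝ) : ℂ) * Complex.I) := by
  have hp : (0 : ℝ) < p := by exact_mod_cast NeZero.pos p
  have h1 : 0 < ((τ : ℂ) + t * Complex.I).im := by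
    have : ((τ : ℂ) + t * Complex.I).im = τ.im + t := by simp
    rw [this]; exact add_pos τ.im_pos ht
  have h2 : 0 < (((tpD p • τ : ℍ) : ℂ) + ((p * t : ℝ) : ℂ) * Complex.I).im := by
    have : (((tpD p • τ : ℍ) : ℂ) + ((p * t : ℝ) : ℂ) * Complex.I).im = (tpD p • τ).im + p * t := by
      simp
    rw [this]; exact add_pos (tpD p • τ).im_pos (mul_pos hp ht)
  have hL : ((ofComplex ((τ : ℂ) + t * Complex.I) : ℍ) : ℂ) = (τ : ℂ) + t * Complex.I := by
    rw [ofComplex_apply_of_im_pos h1]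
  have hR : ((ofComplex (((tpD p • τ : ℍ) : ℂ) + ((p * t : ℝ) : ℂ) * Complex.I) : ℍ) : ℂ) =
      ((tpD p • τ : ℍ) : ℂ) + ((p * t : ℝ) : ℂ) * Complex.I := by
    rw [ofComplex_apply_of_im_pos h2]
  ext1
  rw [coe_tpD_smul, hL, hR, coe_tpD_smul]
  push_cast
  ring

/-- **Affine change of variables along vertical rays** (weight `2`): for ANY function `φ` on `ℍ`,
`V_{φ ∣ diag(p,1)}(τ) = V_φ(p τ)` — `(φ ∣[2] diag(p,1))(τ + it) = p · φ(pτ + ipt)` and the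
substitution `s = p t`. [folklore] -/
theorem verticalIntegral_slash_tpD (p : ℕ) [NeZero p] (φ : ℍ → ℂ) (τ : ℍ) :
    verticalIntegral (φ ∣[(2 : ℤ)] tpD p) τ = verticalIntegral φ (tpD p • τ) := by
  have hp : (0 : ℝ) < p := by exact_mod_cast NeZero.pos p
  unfold verticalIntegral
  congr 1
  have hstep : ∫ t in Ioi (0 : ℝ), (φ ∣[(2 : ℤ)] tpD p) (ofComplex ((τ : ℂ) + t * Complex.I)) =
      ∫ t in Ioi (0 : ℝ), (p : ℂ) *
        (fun s : ℝ ↦ φ (ofComplex (((tpD p • τ : ℍ) : ℂ) + s * Complex.I))) ((p : ℝ) * t) := by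
    refine setIntegral_congr_fun measurableSet_Ioi fun t ht ↦ ?_
    dsimp only
    rw [slash_tpD_apply, tpD_smul_ofComplex_coe p τ ht]
    norm_num
  rw [hstep, integral_const_mul, integral_comp_mul_left_Ioi
    (fun s : ℝ ↦ φ (ofComplex (((tpD p • τ : ℍ) : ℂ) + s * Complex.I))) 0 hp, mul_zero,
    Complex.real_smul, ← mul_assoc, ofReal_inv, ofReal_natCast,
    mul_inv_cancel₀ (by exact_mod_cast NeZero.ne p : (p : ℂ) ≠ 0), one_mul]

/-- `V` is `ℂ`-linear in the integrand: `V_{c·φ} = c · V_φ`. [folklore] -/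
theorem verticalIntegral_const_mul (c : ℂ) (φ : ℍ → ℂ) (τ : ℍ) :
    verticalIntegral (fun z ↦ c * φ z) τ = c * verticalIntegral φ τ := by
  unfold verticalIntegral
  rw [integral_const_mul]
  ring


/-! ### The Atkin–Lehner matrix `w(3)` at a level `N` with `3 ∥ N` -/

section AtkinLehnerThree

variable {N : ℕ} [NeZero N]

/-- `w(3) = β(3) · diag(3, 1)` in `GL(2, ℝ)`. [cite: Knapp1993, (9.62)] -/
theorem alW_eq (N : ℕ) : glCast (atkinLehnerW N 3 : GL (Fin 2) ℚ) = mapGL ℝ (atkinLehnerSL N 3) * tpD 3 := glCast_atkinLehnerW N 3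

/-- In weight `2` the scalar matrix `diag(p, p) = diag(p,1)·diag(1,p)` slashes trivially:
`φ ∣[2] (p·1) = φ`. [folklore] -/
theorem slash_tpD_mul_tpG (p : ℕ) [NeZero p] (φ : ℍ → ℂ) : φ ∣[(2 : ℤ)] (tpD p * tpG p) = φ := by
  have hp : (0 : ℝ) < p := by exact_mod_cast NeZero.pos p
  have hval : ((tpD p * tpG p : GL (Fin 2) ℝ) : Matrix (Fin 2) (Fin 2) ℝ) =
      !![(p : ℝ), 0; 0, (p : ℝ)] := by
    rw [Matrix.GeneralLinearGroup.coe_mul, val_tpG, val_tpD]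
    ext i j
    fin_cases i <;> fin_cases j <;> simp [Matrix.mul_apply, Fin.sum_univ_two]
  have hdet : (tpD p * tpG p).det.val = (p : ℝ) * p := by
    rw [Matrix.GeneralLinearGroup.val_det_apply, hval, Matrix.det_fin_two_of]; ring
  have hdetpos : 0 < (tpD p * tpG p).det.val := by rw [hdet]; positivity
  ext τ
  rw [ModularForm.slash_apply, σ_eq_self hdetpos, tpD_mul_tpG_smul, hdet]
  have hden : denom (tpD p * tpG p) τ = (p : ℂ) := by
    rw [denom]
    have h10 : ((tpD p * tpG p : GL (Fin 2) ℝ) 1 0 : ℝ) = 0 := by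
      rw [show ((tpD p * tpG p : GL (Fin 2) ℝ) 1 0 : ℝ) =
        ((tpD p * tpG p : GL (Fin 2) ℝ) : Matrix (Fin 2) (Fin 2) ℝ) 1 0 from rfl, hval]; simp
    have h11 : ((tpD p * tpG p : GL (Fin 2) ℝ) 1 1 : ℝ) = p := by
      rw [show ((tpD p * tpG p : GL (Fin 2) ℝ) 1 1 : ℝ) =
        ((tpD p * tpG p : GL (Fin 2) ℝ) : Matrix (Fin 2) (Fin 2) ℝ) 1 1 from rfl, hval]; simp
    rw [h10, h11]; push_cast; ring
  rw [hden, abs_of_pos (mul_pos hp hp)]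
  have hp0 : (p : ℂ) ≠ 0 := by exact_mod_cast NeZero.ne p
  push_cast
  rw [zpow_neg, zpow_ofNat]
  field_simp

variable (h3N : 3 ∣ N) (hc : Nat.Coprime 3 (N / 3)) {f : CuspForm (Gamma0 N) 2} {ε : ℂ}
  (hε : atkinLehnerInvolution N 2 3 f = ε • f)
include h3N hc hε

/-- `f ∣[2] w(3) = ε · f` as functions on `ℍ` (one-term formula for `w_3` at `3 ∥ N` and the eigen-equation
`w_3 f = ε f`). [cite: Knapp1993, Lemma 9.24] -/
theorem slash_alW_eq : (⇑f ∣[(2 : ℤ)] glCast (atkinLehnerW N 3 : GL (Fin 2) ℚ)) = fun τ ↦ ε * f τ :=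
  funext (slash_atkinLehnerW_apply h3N hc hε)

/-- **`K`-constancy of the Eichler integral under `w(3)`**: there is a constant `K` with
`V_f(w(3)·z) = ε V_f(z) + K` for every `z ∈ ℍ` (`w(3) = β(3) diag(3,1)`, Manin's
`V_f(βz) − V_{f∣β}(z) = const` for `β ∈ SL(2,ℤ)`, the affine substitution for `diag(3,1)`, and
`f ∣ w(3) = ε f`). [cite: Manin1972, Prop. 1.4] [cite: Knapp1993, Lemma 9.24] -/
theorem exists_eichlerIntegral_alW_smul :
    ∃ K : ℂ, ∀ z : ℍ, eichlerIntegral f (glCast (atkinLehnerW N 3 : GL (Fin 2) ℚ) • z) = ε * eichlerIntegral f z + K := by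
  set ξ : SL(2, ℤ) := atkinLehnerSL N 3 with hξ
  refine ⟨verticalIntegral ⇑f (ξ • UpperHalfPlane.I) -
    verticalIntegral (⇑f ∣[(2 : ℤ)] ξ) UpperHalfPlane.I, fun z ↦ ?_⟩
  have h1 : glCast (atkinLehnerW N 3 : GL (Fin 2) ℚ) • z = ξ • (tpD 3 • z) := by
    rw [alW_eq, mul_smul]; rfl
  have h2 := verticalIntegral_smul_sub_eq ξ (isCuspFunction_one f) (isCuspFunction_slash f ξ)
    (tpD 3 • z) UpperHalfPlane.I
  have h3 : verticalIntegral (⇑f ∣[(2 : ℤ)] ξ) (tpD 3 • z) = ε * verticalIntegral ⇑f z := by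
    rw [← verticalIntegral_slash_tpD, ModularForm.SL_slash, ← SlashAction.slash_mul,
      show (ξ : GL (Fin 2) ℝ) * tpD 3 = glCast (atkinLehnerW N 3 : GL (Fin 2) ℚ) from (alW_eq N).symm, slash_alW_eq h3N hc hε,
      verticalIntegral_const_mul]
  show verticalIntegral ⇑f (glCast (atkinLehnerW N 3 : GL (Fin 2) ℚ) • z) = ε * verticalIntegral ⇑f z + _
  rw [h1]
  linear_combination h2 + h3

/-- **(i) `w(3)`-equivariance of Manin's period homomorphism**: if `γ' w(3) = w(3) γ` in `GL(2,ℝ)`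
(`γ, γ' ∈ Γ₀(N)`, i.e. `γ' = w(3) γ w(3)⁻¹`), then `{∞, γ'∞}_f = ε {∞, γ∞}_f`.
[cite: Manin1972, Prop. 1.4] [cite: Knapp1993, Lemma 9.24] -/
theorem cuspSymbol_eq_mul_of_conj_alW (γ γ' : Gamma0 N)
    (hconj : mapGL ℝ (γ' : SL(2, ℤ)) * glCast (atkinLehnerW N 3 : GL (Fin 2) ℚ) = glCast (atkinLehnerW N 3 : GL (Fin 2) ℚ) * mapGL ℝ (γ : SL(2, ℤ))) :
    cuspSymbol f γ' = ε * cuspSymbol f γ := by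
  obtain ⟨K, hK⟩ := exists_eichlerIntegral_alW_smul h3N hc hε
  have E2 := eichlerIntegral_smul_sub_holds f
  have hz : ((γ' : SL(2, ℤ)) • (glCast (atkinLehnerW N 3 : GL (Fin 2) ℚ) • UpperHalfPlane.I) : ℍ) =
      glCast (atkinLehnerW N 3 : GL (Fin 2) ℚ) • ((γ : SL(2, ℤ)) • UpperHalfPlane.I) := by
    change mapGL ℝ (γ' : SL(2, ℤ)) • (glCast (atkinLehnerW N 3 : GL (Fin 2) ℚ) • UpperHalfPlane.I) =
      glCast (atkinLehnerW N 3 : GL (Fin 2) ℚ) • (mapGL ℝ (γ : SL(2, ℤ)) • UpperHalfPlane.I)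
    rw [← mul_smul, ← mul_smul, hconj]
  rw [← E2 γ' (glCast (atkinLehnerW N 3 : GL (Fin 2) ℚ) • UpperHalfPlane.I), ← E2 γ UpperHalfPlane.I, hz, hK, hK]
  ring

variable (hε1 : ε ^ 2 = 1)
include hε1

omit h3N hc hε in
/-- `{∞, γ₀∞}_f = (1 + ε) K` for `w(3)² = γ₀ · (3·1)`, `K` the constant of
`exists_eichlerIntegral_alW_smul` (read at the point `z`). [cite: Knapp1993, Lemma 9.24] -/
theorem cuspSymbol_sq_eq (γ₀ : Gamma0 N)
    (hsq : glCast (atkinLehnerW N 3 : GL (Fin 2) ℚ) * glCast (atkinLehnerW N 3 : GL (Fin 2) ℚ) = mapGL ℝ (γ₀ : SL(2, ℤ)) * (tpD 3 * tpG 3)) {K : ℂ}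
    (hK : ∀ z : ℍ, eichlerIntegral f (glCast (atkinLehnerW N 3 : GL (Fin 2) ℚ) • z) = ε * eichlerIntegral f z + K) :
    cuspSymbol f γ₀ = (1 + ε) * K := by
  have E2 := eichlerIntegral_smul_sub_holds f γ₀ UpperHalfPlane.I
  have hz : ((γ₀ : SL(2, ℤ)) • UpperHalfPlane.I : ℍ) = glCast (atkinLehnerW N 3 : GL (Fin 2) ℚ) • (glCast (atkinLehnerW N 3 : GL (Fin 2) ℚ) • UpperHalfPlane.I) := by
    change mapGL ℝ (γ₀ : SL(2, ℤ)) • UpperHalfPlane.I = _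
    rw [← mul_smul, hsq, mul_smul, tpD_mul_tpG_smul]
  rw [← E2, hz, hK, hK]
  linear_combination (eichlerIntegral f UpperHalfPlane.I) * hε1

omit [NeZero N] h3N hc hε hε1 in
/-- `diag(1,3) · S = S · diag(3,1)` in `GL(2,ℝ)` (`S = (0 −1; 1 0)`). [folklore] -/
theorem tpG_mul_S_eq : tpG 3 * mapGL ℝ ModularGroup.S = mapGL ℝ ModularGroup.S * tpD 3 := by
  apply Matrix.GeneralLinearGroup.ext
  intro i j
  rw [Matrix.GeneralLinearGroup.coe_mul, Matrix.GeneralLinearGroup.coe_mul, val_tpG, val_tpD,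
    val_mapGL', ModularGroup.coe_S]
  fin_cases i <;> fin_cases j <;> simp [Matrix.mul_apply, Fin.sum_univ_two]

omit [NeZero N] h3N hc hε hε1 in
/-- `w(3) · S · diag(3,1) = (β(3) S) · (3·1)` in `GL(2,ℝ)` (`diag(3,1) S diag(3,1) = 3 S`). [folklore] -/
theorem alW_mul_S_mul_tpD_eq :
    glCast (atkinLehnerW N 3 : GL (Fin 2) ℚ) * mapGL ℝ ModularGroup.S * tpD 3 =
      mapGL ℝ (atkinLehnerSL N 3 * ModularGroup.S) * (tpD 3 * tpG 3) := by
  rw [alW_eq, map_mul]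
  apply Matrix.GeneralLinearGroup.ext
  intro i j
  simp only [Matrix.GeneralLinearGroup.coe_mul, val_tpG, val_tpD, val_mapGL', ModularGroup.coe_S]
  fin_cases i <;> fin_cases j <;> simp [Matrix.mul_apply, Fin.sum_univ_two]

omit hε1 in
/-- `f ∣ β(3) = ε · (f ∣ diag(1,3))` (`β(3) = w(3) diag(3,1)⁻¹`, `diag(3,1)diag(1,3)` slashes trivially).
[cite: Knapp1993, Lemma 9.24] -/
theorem slash_atkinLehnerSL_eq :
    (⇑f ∣[(2 : ℤ)] mapGL ℝ (atkinLehnerSL N 3)) = fun τ ↦ ε * (⇑f ∣[(2 : ℤ)] tpG 3) τ := by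
  have h : (⇑f ∣[(2 : ℤ)] mapGL ℝ (atkinLehnerSL N 3)) ∣[(2 : ℤ)] (tpD 3 * tpG 3) =
      (fun τ ↦ ε * f τ) ∣[(2 : ℤ)] tpG 3 := by
    rw [SlashAction.slash_mul, ← SlashAction.slash_mul _ _ (tpD 3), ← alW_eq,
      slash_alW_eq h3N hc hε]
  rw [slash_tpD_mul_tpG] at h
  rw [h]
  have hε' : (fun τ ↦ ε * f τ) = ε • (⇑f : ℍ → ℂ) := by ext τ; simp
  rw [hε', ModularForm.smul_slash, σ_eq_self (by
    rw [Matrix.GeneralLinearGroup.val_det_apply, val_tpG, Matrix.det_fin_two_of]; norm_num)]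
  ext τ; simp

omit hε1 in
/-- **The constant `K` identified**: `K = {∞, y/3}_f − ε {∞, 0}_f`, `y = β(3)₀₁` (`w(3)·0 = y/3`):
from `{∞, g∞}_f = V_f(gτ) − V_{f∣g}(τ)` at `g = S` and `g = β(3) S`, the affine substitution for
`diag(3,1)` and `diag(3,1) S diag(3,1) = 3S`. [cite: Manin1972, Prop. 1.4] [cite: Knapp1993, Lemma 9.24] -/
theorem modularSymbol_alW_zero_sub {K : ℂ}
    (hK : ∀ z : ℍ, eichlerIntegral f (glCast (atkinLehnerW N 3 : GL (Fin 2) ℚ) • z) = ε * eichlerIntegral f z + K) :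
    modularSymbol f (((atkinLehnerSL N 3 : SL(2, ℤ)) 0 1 : ℚ) / 3) - ε * modularSymbol f 0 = K := by
  set ξ : SL(2, ℤ) := atkinLehnerSL N 3 with hξ
  obtain ⟨h10, h11⟩ := atkinLehnerSL_apply_one N 3 hc
  -- entries of `ξ S`
  have hS00 : ((ξ * ModularGroup.S : SL(2, ℤ)) 0 0 : ℤ) = ξ 0 1 := by
    simp [Matrix.mul_apply, Fin.sum_univ_two, ModularGroup.coe_S]
  have h11' : (ξ 1 1 : ℤ) = 3 := by rw [hξ, h11]; norm_num
  have hS10 : ((ξ * ModularGroup.S : SL(2, ℤ)) 1 0 : ℤ) = 3 := by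
    simp [Matrix.mul_apply, Fin.sum_univ_two, ModularGroup.coe_S, h11']
  have hcS : ((ξ * ModularGroup.S : SL(2, ℤ)) 1 0 : ℤ) ≠ 0 := by rw [hS10]; norm_num
  have hcS' : ((ModularGroup.S : SL(2, ℤ)) 1 0 : ℤ) ≠ 0 := by simp [ModularGroup.coe_S]
  -- E1 at `ξ S` (cusp `y/3`) at the point `τ`, and at `S` (cusp `0`) at the point `diag(3,1) τ`
  set τ : ℍ := UpperHalfPlane.I
  have E1a := modularSymbol_smul_infty f (ξ * ModularGroup.S) hcS τ
  have E1b := modularSymbol_smul_infty f ModularGroup.S hcS' (tpD 3 • τ)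
  rw [hS00, hS10] at E1a
  have h0 : (((ModularGroup.S : SL(2, ℤ)) 0 0 : ℤ) : ℚ) / (((ModularGroup.S : SL(2, ℤ)) 1 0 : ℤ) : ℚ)
      = 0 := by simp [ModularGroup.coe_S]
  rw [h0] at E1b
  -- `f ∣ ξS = ε · (f ∣ S) ∣ diag(3,1)` and the affine substitution
  have hslash : (⇑f ∣[(2 : ℤ)] (ξ * ModularGroup.S)) =
      fun z ↦ ε * ((⇑f ∣[(2 : ℤ)] ModularGroup.S) ∣[(2 : ℤ)] tpD 3) z := by
    show (⇑f ∣[(2 : ℤ)] mapGL ℝ (ξ * ModularGroup.S)) =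
      fun z ↦ ε * ((⇑f ∣[(2 : ℤ)] mapGL ℝ ModularGroup.S) ∣[(2 : ℤ)] tpD 3) z
    rw [map_mul, SlashAction.slash_mul, hξ, slash_atkinLehnerSL_eq h3N hc hε]
    have hε' : (fun z ↦ ε * (⇑f ∣[(2 : ℤ)] tpG 3) z) = ε • (⇑f ∣[(2 : ℤ)] tpG 3) := by ext z; simp
    rw [hε', ModularForm.smul_slash, σ_eq_self (by simp),
      ← SlashAction.slash_mul, ← SlashAction.slash_mul, tpG_mul_S_eq]
    ext z; simp
  have hV : verticalIntegral (⇑f ∣[(2 : ℤ)] (ξ * ModularGroup.S)) τ =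
      ε * verticalIntegral (⇑f ∣[(2 : ℤ)] ModularGroup.S) (tpD 3 • τ) := by
    rw [hslash, verticalIntegral_const_mul, verticalIntegral_slash_tpD]
  -- the points: `ξS · τ = w(3) · (S · (diag(3,1) · τ))`
  have hpt : ((ξ * ModularGroup.S : SL(2, ℤ)) • τ : ℍ) =
      glCast (atkinLehnerW N 3 : GL (Fin 2) ℚ) • ((ModularGroup.S : SL(2, ℤ)) • (tpD 3 • τ)) := by
    change mapGL ℝ (ξ * ModularGroup.S) • τ = glCast (atkinLehnerW N 3 : GL (Fin 2) ℚ) • (mapGL ℝ ModularGroup.S • (tpD 3 • τ))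
    rw [← mul_smul, ← mul_smul, alW_mul_S_mul_tpD_eq, mul_smul, tpD_mul_tpG_smul]
  have E1a' : modularSymbol f (((ξ 0 1 : ℤ) : ℚ) / ((3 : ℤ) : ℚ)) =
      eichlerIntegral f (glCast (atkinLehnerW N 3 : GL (Fin 2) ℚ) • ((ModularGroup.S : SL(2, ℤ)) • (tpD 3 • τ))) -
        ε * verticalIntegral (⇑f ∣[(2 : ℤ)] ModularGroup.S) (tpD 3 • τ) := by
    rw [E1a, hpt, hV]
  rw [hK] at E1a'
  have h3q : ((3 : ℤ) : ℚ) = 3 := by norm_num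
  rw [h3q] at E1a'
  rw [E1a', E1b]
  ring

/-- **(ii) the period of `w(3)²/3`**: for `w(3)² = γ₀·(3·1)` (`γ₀ ∈ Γ₀(N)`),
`{∞, γ₀∞}_f = (1 + ε)({∞, y/3}_f − {∞, 0}_f)` with `y/3 = w(3)·0`. [cite: Knapp1993, Lemma 9.24]
[cite: Manin1972, Prop. 1.4] -/
theorem cuspSymbol_sq_eq_modularSymbol (γ₀ : Gamma0 N)
    (hsq : glCast (atkinLehnerW N 3 : GL (Fin 2) ℚ) * glCast (atkinLehnerW N 3 : GL (Fin 2) ℚ) = mapGL ℝ (γ₀ : SL(2, ℤ)) * (tpD 3 * tpG 3)) :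
    cuspSymbol f γ₀ =
      (1 + ε) * (modularSymbol f (((atkinLehnerSL N 3 : SL(2, ℤ)) 0 1 : ℚ) / 3) - modularSymbol f 0) := by
  obtain ⟨K, hK⟩ := exists_eichlerIntegral_alW_smul h3N hc hε
  rw [cuspSymbol_sq_eq hε1 γ₀ hsq hK, ← modularSymbol_alW_zero_sub h3N hc hε hK]
  linear_combination (-(modularSymbol f 0)) * hε1


/-! ### Integer-matrix interface (for the `GL₂(ℤ[1/3])` orbit argument) -/

omit [NeZero N] h3N hε hε1 in
/-- The real matrix of `w(3)` is the cast of `MultThreeOrbit.Wint (N / 3) ((atkinLehnerSL N 3 : SL(2, ℤ)) 0 0) ((atkinLehnerSL N 3 : SL(2, ℤ)) 0 1)`. [cite: Knapp1993, (9.62)] -/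
theorem val_alW : ((glCast (atkinLehnerW N 3 : GL (Fin 2) ℚ) : GL (Fin 2) ℝ) : Matrix (Fin 2) (Fin 2) ℝ) =
    (MultThreeOrbit.Wint (N / 3) ((atkinLehnerSL N 3 : SL(2, ℤ)) 0 0) ((atkinLehnerSL N 3 : SL(2, ℤ)) 0 1)).map (Int.castRingHom ℝ : ℤ → ℝ) := by
  obtain ⟨h10, h11⟩ := atkinLehnerSL_apply_one N 3 hc
  rw [alW_eq, Matrix.GeneralLinearGroup.coe_mul, val_mapGL', val_tpD, MultThreeOrbit.Wint]
  ext i j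
  fin_cases i <;> fin_cases j <;> simp [Matrix.mul_apply, Fin.sum_univ_two, h10, h11] <;> ring

omit [NeZero N] h3N hε hε1 in
/-- Dictionary: a commutation relation with `w(3)` in `GL(2,ℝ)` is the same as the corresponding identity of
INTEGER matrices. [folklore] -/
theorem mapGL_mul_alW_eq_iff (A B : SL(2, ℤ)) :
    mapGL ℝ A * glCast (atkinLehnerW N 3 : GL (Fin 2) ℚ) = glCast (atkinLehnerW N 3 : GL (Fin 2) ℚ) * mapGL ℝ B ↔
      (A : Matrix (Fin 2) (Fin 2) ℤ) * MultThreeOrbit.Wint (N / 3) ((atkinLehnerSL N 3 : SL(2, ℤ)) 0 0) ((atkinLehnerSL N 3 : SL(2, ℤ)) 0 1) = MultThreeOrbit.Wint (N / 3) ((atkinLehnerSL N 3 : SL(2, ℤ)) 0 0) ((atkinLehnerSL N 3 : SL(2, ℤ)) 0 1) * (B : Matrix (Fin 2) (Fin 2) ℤ) := by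
  rw [← Units.val_inj, Units.val_mul, Units.val_mul, val_alW hc]
  have hA : ((mapGL ℝ A : GL (Fin 2) ℝ) : Matrix (Fin 2) (Fin 2) ℝ) =
      (A : Matrix (Fin 2) (Fin 2) ℤ).map (Int.castRingHom ℝ : ℤ → ℝ) := val_mapGL' A
  have hB : ((mapGL ℝ B : GL (Fin 2) ℝ) : Matrix (Fin 2) (Fin 2) ℝ) =
      (B : Matrix (Fin 2) (Fin 2) ℤ).map (Int.castRingHom ℝ : ℤ → ℝ) := val_mapGL' B
  have hinj : Function.Injective (RingHom.mapMatrix (Int.castRingHom ℝ) :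
      Matrix (Fin 2) (Fin 2) ℤ →+* Matrix (Fin 2) (Fin 2) ℝ) := fun M M' hM ↦ by
    ext i j
    have := congrFun (congrFun hM i) j
    simpa using this
  rw [hA, hB, ← RingHom.mapMatrix_apply, ← RingHom.mapMatrix_apply, ← RingHom.mapMatrix_apply,
    ← map_mul, ← map_mul, hinj.eq_iff]


omit [NeZero N] hε hε1 in
/-- **`w(3)` normalises `Γ₀(N)`, integer form**: every `γ ∈ Γ₀(N)` has a conjugate `γ' ∈ Γ₀(N)` with
`γ' · W = W · γ` (`3 ∥ N`). [cite: Knapp1993, Lemma 9.24] -/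
theorem exists_conj_alWInt (γ : Gamma0 N) :
    ∃ γ' : Gamma0 N, ((γ' : SL(2, ℤ)) : Matrix (Fin 2) (Fin 2) ℤ) * MultThreeOrbit.Wint (N / 3) ((atkinLehnerSL N 3 : SL(2, ℤ)) 0 0) ((atkinLehnerSL N 3 : SL(2, ℤ)) 0 1) =
      MultThreeOrbit.Wint (N / 3) ((atkinLehnerSL N 3 : SL(2, ℤ)) 0 0) ((atkinLehnerSL N 3 : SL(2, ℤ)) 0 1) * ((γ : SL(2, ℤ)) : Matrix (Fin 2) (Fin 2) ℤ) := by
  have hx : (mapGL ℝ (γ : SL(2, ℤ)) : GL (Fin 2) ℝ) ∈ (Gamma0 N : Subgroup (GL (Fin 2) ℝ)) :=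
    Subgroup.mem_map.mpr ⟨γ, γ.2, rfl⟩
  obtain ⟨γ', hγ', h⟩ := Subgroup.mem_map.mp (atkinLehnerW_mul_mul_inv_mem N 3 h3N hc hx)
  refine ⟨⟨γ', hγ'⟩, (mapGL_mul_alW_eq_iff hc γ' γ).mp ?_⟩
  rw [h, inv_mul_cancel_right]

omit [NeZero N] hε hε1 in
/-- **`w(3)² ∈ 3·Γ₀(N)`, integer form**: `W · W = 3 γ₀` for some `γ₀ ∈ Γ₀(N)` (`3 ∥ N`).
[cite: Knapp1993, Lemma 9.24] -/
theorem exists_sq_alWInt :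
    ∃ γ₀ : Gamma0 N, MultThreeOrbit.Wint (N / 3) ((atkinLehnerSL N 3 : SL(2, ℤ)) 0 0) ((atkinLehnerSL N 3 : SL(2, ℤ)) 0 1) * MultThreeOrbit.Wint (N / 3) ((atkinLehnerSL N 3 : SL(2, ℤ)) 0 0) ((atkinLehnerSL N 3 : SL(2, ℤ)) 0 1) = (3 : ℤ) • ((γ₀ : SL(2, ℤ)) : Matrix (Fin 2) (Fin 2) ℤ) := by
  obtain ⟨γ₀, hγ₀, h⟩ := exists_atkinLehnerW_mul_self N 3 h3N hc
  refine ⟨⟨γ₀, hγ₀⟩, ?_⟩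
  have hinj : Function.Injective (RingHom.mapMatrix (Int.castRingHom ℝ) :
      Matrix (Fin 2) (Fin 2) ℤ →+* Matrix (Fin 2) (Fin 2) ℝ) := fun M M' hM ↦ by
    ext i j
    have := congrFun (congrFun hM i) j
    simpa using this
  apply hinj
  have h' := congrArg (fun g : GL (Fin 2) ℝ ↦ (g : Matrix (Fin 2) (Fin 2) ℝ)) h
  simp only [Matrix.GeneralLinearGroup.coe_mul, val_alW hc, val_mapGL', val_tpD, val_tpG] at h'
  rw [map_mul, RingHom.mapMatrix_apply, h', map_zsmul, RingHom.mapMatrix_apply]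
  ext i j
  fin_cases i <;> fin_cases j <;> simp [Matrix.mul_apply, Fin.sum_univ_two] <;> ring

omit hε1 in
/-- **(i), integer form**: `γ' W = W γ` (integer matrices) implies `{∞, γ'∞}_f = ε {∞, γ∞}_f`.
[cite: Manin1972, Prop. 1.4] [cite: Knapp1993, Lemma 9.24] -/
theorem cuspSymbol_eq_mul_of_conj_alWInt (γ γ' : Gamma0 N)
    (hconj : ((γ' : SL(2, ℤ)) : Matrix (Fin 2) (Fin 2) ℤ) * MultThreeOrbit.Wint (N / 3) ((atkinLehnerSL N 3 : SL(2, ℤ)) 0 0) ((atkinLehnerSL N 3 : SL(2, ℤ)) 0 1) =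
      MultThreeOrbit.Wint (N / 3) ((atkinLehnerSL N 3 : SL(2, ℤ)) 0 0) ((atkinLehnerSL N 3 : SL(2, ℤ)) 0 1) * ((γ : SL(2, ℤ)) : Matrix (Fin 2) (Fin 2) ℤ)) :
    cuspSymbol f γ' = ε * cuspSymbol f γ :=
  cuspSymbol_eq_mul_of_conj_alW h3N hc hε γ γ' ((mapGL_mul_alW_eq_iff hc _ _).mpr hconj)

/-- **(ii), integer form**: `W W = 3 γ₀` (integer matrices) implies
`{∞, γ₀∞}_f = (1 + ε)({∞, y/3}_f − {∞, 0}_f)`, `y = W₀₁`. [cite: Manin1972, Prop. 1.4]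
[cite: Knapp1993, Lemma 9.24] -/
theorem cuspSymbol_eq_of_sq_alWInt (γ₀ : Gamma0 N)
    (hsq : MultThreeOrbit.Wint (N / 3) ((atkinLehnerSL N 3 : SL(2, ℤ)) 0 0) ((atkinLehnerSL N 3 : SL(2, ℤ)) 0 1) * MultThreeOrbit.Wint (N / 3) ((atkinLehnerSL N 3 : SL(2, ℤ)) 0 0) ((atkinLehnerSL N 3 : SL(2, ℤ)) 0 1) = (3 : ℤ) • ((γ₀ : SL(2, ℤ)) : Matrix (Fin 2) (Fin 2) ℤ)) :
    cuspSymbol f γ₀ =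
      (1 + ε) * (modularSymbol f (((atkinLehnerSL N 3 : SL(2, ℤ)) 0 1 : ℚ) / 3) - modularSymbol f 0) := by
  refine cuspSymbol_sq_eq_modularSymbol h3N hc hε hε1 γ₀ ?_
  rw [← Units.val_inj, Units.val_mul, Units.val_mul, val_alW hc]
  have h0 : ((mapGL ℝ (γ₀ : SL(2, ℤ)) : GL (Fin 2) ℝ) : Matrix (Fin 2) (Fin 2) ℝ) =
      ((γ₀ : SL(2, ℤ)) : Matrix (Fin 2) (Fin 2) ℤ).map (Int.castRingHom ℝ : ℤ → ℝ) := val_mapGL' _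
  have h3 : ((tpD 3 * tpG 3 : GL (Fin 2) ℝ) : Matrix (Fin 2) (Fin 2) ℝ) =
      (!![3, 0; 0, 3] : Matrix (Fin 2) (Fin 2) ℤ).map (Int.castRingHom ℝ : ℤ → ℝ) := by
    rw [Matrix.GeneralLinearGroup.coe_mul, val_tpD, val_tpG]
    ext i j
    fin_cases i <;> fin_cases j <;> simp [Matrix.mul_apply, Fin.sum_univ_two]
  have h4 : ((γ₀ : SL(2, ℤ)) : Matrix (Fin 2) (Fin 2) ℤ) * !![3, 0; 0, 3] =
      (3 : ℤ) • ((γ₀ : SL(2, ℤ)) : Matrix (Fin 2) (Fin 2) ℤ) := by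
    ext i j
    fin_cases i <;> fin_cases j <;> simp [Matrix.mul_apply, Fin.sum_univ_two] <;> ring
  rw [h0, h3, ← RingHom.mapMatrix_apply, ← RingHom.mapMatrix_apply, ← RingHom.mapMatrix_apply,
    ← map_mul, ← map_mul, hsq, h4]

end AtkinLehnerThree

end Summit.BirchSwinnertonDyer.BirchSwinnertonDyer.Theorems.MultThreeAL

end
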